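import Mathlib.LinearAlgebra.Matrix.PosDef
import Summits.RiemannHypothesis.RiemannHypothesis.Theorems.NymanBeurlingHeadTail
import Summits.RiemannHypothesis.RiemannHypothesis.Theorems.NymanBeurlingTailLeverage
import HarnessLib

/-!
# RiemannHypothesis / Nyman–Beurling — the Gram matrices of the Báez-Duarte dilates are POSITIVE DEFINITE (RH-FREE per N)

Column LI/NB of the RH ladder, rung L-P(P2) «structure of the NB minimiser», PROOF-OF-DATA for cell `pub/rh-li`
(theory memo `theory/TARGETS.md` §10.2 (a) `NbGramPosDef`).  The DATA rung of this column (DATA.md §L, certified lineages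
R / A, float lineage C2) computes `c⋆_N = G⁻¹ b` and `d_N² = 1 − b·c⋆_N`; this file proves that the linear algebra behind those
rows is well-posed for EVERY `N`:

* `nbRho_eq_of_mem_nbI` / `sum_mul_nbRho_eq_of_mem_nbI`: on the Farey cell `I_{n+1} = (1/(n+2), 1/(n+1)]` the dilate
  `ρ_{k+1}(x) = {1/((k+1)x)}` is `1/((k+1)x) − ⌊(n+1)/(k+1)⌋`, so the approximant is `f_c(x) = τ/x − D_c(n+1)` with
  `τ = tailConst c` and the integer bookkeeping functional `D_c(m) = Σ_k c_k ⌊m/(k+1)⌋`;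
* `eq_zero_of_integral_sq_sum_eq_zero`: the dilates `ρ_1, …, ρ_N` are LINEARLY INDEPENDENT in `L²(0,1]` — if
  `∫_{(0,1]} f_c² = 0` then `τ = 0` (tail leverage, `nbTailLeverageBound`), every `D_c(m) = 0` (each cell has positive
  length), hence `Σ_{(k+1) ∣ m} c_k = D_c(m) − D_c(m−1) = 0` for all `m`, a unit lower-triangular system: `c = 0`;
* `dotProduct_nbGram0Matrix_mulVec` (`c·G⁰c = ∫_{(0,1]} f_c²`), `dotProduct_nbGramMatrix_mulVec` (`c·Gc = c·G⁰c + τ²`);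
* `nbGram0Matrix_posDef`, `nbGramMatrix_posDef`: both Gram matrices (Nyman's interval `(0,1]`, Báez-Duarte's `(0,∞)`) are
  positive definite — so the hypothesis `(nbGram0Matrix N).PosDef` of `nbHeadTailIdentity` (T2) is discharged
  (`nbHeadTailIdentity'`) and `nbMinimiser N = G⁻¹ b` is THE minimiser (sequel file `NymanBeurlingMinimiser.lean`).

RH-FREE [rh-li-eng-3]: finite-`N` linear algebra and Lebesgue integrals on `(0,1]`; no statement about `d_N → 0` is made or
used; the criterion `RH ⇔ d_N → 0` (`baezDuarte_iff_holds`) is RH-EQUIVALENT and untouched.  Nothing here bears on the truth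
of RH.
-/

noncomputable section

-- D-0017: `Summit.<S>.<S>.…` is the designed namespace of a single-problem summit.
set_option linter.dupNamespace false

open MeasureTheory Set Finset
open scoped Matrix

namespace Summit.RiemannHypothesis.RiemannHypothesis.Theorems.NbTheory

open Literature.NumberTheory.LFunctions Literature.NumberTheory.LFunctions.BaezDuarteOnlyIf

namespace GramPosDef

/-! ## The dilates on one Farey cell -/

/-- On the cell `I_{n+1} = (1/(n+2), 1/(n+1)]` the integer part of `1/((k+1)x)` is the natural quotient `(n+1)/(k+1)`. -/
lemma floor_dilate_eq_of_mem_nbI (k : ℕ) {n : ℕ} {x : ℝ} (hx : x ∈ nbI n) :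
    ⌊1 / (((k : ℝ) + 1) * x)⌋₊ = (n + 1) / (k + 1) := by
  have h1 : 1 / (((k : ℝ) + 1) * x) = (1 / x) / ((k + 1 : ℕ) : ℝ) := by
    push_cast
    rw [div_div, mul_comm]
  rw [h1, Nat.floor_div_natCast, floor_eq_of_mem_nbI hx]

/-- On `I_{n+1}`: `ρ_{k+1}(x) = 1/((k+1)x) − ⌊(n+1)/(k+1)⌋`. -/
lemma nbRho_eq_of_mem_nbI (k : ℕ) {n : ℕ} {x : ℝ} (hx : x ∈ nbI n) :
    nbRho k x = 1 / (((k : ℝ) + 1) * x) - (((n + 1) / (k + 1) : ℕ) : ℝ) := by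
  have hx0 : 0 < x := pos_of_mem_nbI hx
  have hy : (0 : ℝ) ≤ 1 / (((k : ℝ) + 1) * x) := by positivity
  have hfl : ((⌊1 / (((k : ℝ) + 1) * x)⌋ : ℤ) : ℝ) = ((⌊1 / (((k : ℝ) + 1) * x)⌋₊ : ℕ) : ℝ) := by
    exact_mod_cast (Int.natCast_floor_eq_floor hy).symm
  unfold nbRho
  rw [Int.fract, hfl, floor_dilate_eq_of_mem_nbI k hx]

/-- On `I_{n+1}` the approximant is `τ/x − D_c(n+1)`, `D_c(m) = Σ_k c_k ⌊m/(k+1)⌋`. -/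
lemma sum_mul_nbRho_eq_of_mem_nbI {N : ℕ} (c : Fin N → ℝ) {n : ℕ} {x : ℝ} (hx : x ∈ nbI n) :
    ∑ k : Fin N, c k * nbRho k x =
      tailConst c / x - ∑ k : Fin N, c k * (((n + 1) / ((k : ℕ) + 1) : ℕ) : ℝ) := by
  have hx0 : x ≠ 0 := (pos_of_mem_nbI hx).ne'
  simp_rw [nbRho_eq_of_mem_nbI _ hx, mul_sub, Finset.sum_sub_distrib]
  congr 1
  rw [tailConst, Finset.sum_div]
  refine Finset.sum_congr rfl fun k _ ↦ ?_
  have hk : ((k : ℕ) : ℝ) + 1 ≠ 0 := by positivity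
  field_simp

/-! ## The integer bookkeeping functional `D_c(m) = Σ_k c_k ⌊m/(k+1)⌋` -/

/-- `D_c(m+1) − D_c(m) = Σ_{(k+1) ∣ (m+1)} c_k`. -/
lemma sum_floor_succ_sub {N : ℕ} (c : Fin N → ℝ) (m : ℕ) :
    ∑ k : Fin N, c k * (((m + 1) / ((k : ℕ) + 1) : ℕ) : ℝ) -
        ∑ k : Fin N, c k * ((m / ((k : ℕ) + 1) : ℕ) : ℝ) =
      ∑ k : Fin N, (if (k : ℕ) + 1 ∣ m + 1 then c k else 0) := by
  rw [← Finset.sum_sub_distrib]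
  refine Finset.sum_congr rfl fun k _ ↦ ?_
  rw [Nat.succ_div]
  split_ifs <;> push_cast <;> ring

/-- `D_c(0) = 0`. -/
lemma sum_floor_zero {N : ℕ} (c : Fin N → ℝ) :
    ∑ k : Fin N, c k * ((0 / ((k : ℕ) + 1) : ℕ) : ℝ) = 0 := by
  simp

/-- The system `Σ_{(k+1) ∣ (m+1)} c_k = 0` (`m < N`) is unit lower-triangular: it forces `c = 0`. -/
lemma eq_zero_of_sum_dvd_eq_zero {N : ℕ} (c : Fin N → ℝ)
    (h : ∀ m < N, ∑ k : Fin N, (if (k : ℕ) + 1 ∣ m + 1 then c k else 0) = 0) : c = 0 := by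
  have key : ∀ n : ℕ, ∀ j : Fin N, (j : ℕ) = n → c j = 0 := by
    intro n
    induction n using Nat.strong_induction_on with
    | _ n ih =>
      intro j hjn
      have hj := h j j.isLt
      rw [Finset.sum_eq_single j] at hj
      · simpa using hj
      · intro k _ hkj
        split_ifs with hdvd
        · have hle : (k : ℕ) + 1 ≤ (j : ℕ) + 1 := Nat.le_of_dvd (Nat.succ_pos _) hdvd
          have hne : (k : ℕ) ≠ (j : ℕ) := fun e ↦ hkj (Fin.ext e)
          exact ih k (by omega) k rfl
        · rfl
      · simp
  funext j
  exact key j j rfl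

/-! ## Integrals over a cell -/

/-- The approximant is measurable. -/
lemma measurable_sum_mul_nbRho {N : ℕ} (c : Fin N → ℝ) :
    Measurable fun x : ℝ ↦ ∑ k : Fin N, c k * nbRho k x :=
  Finset.measurable_sum _ fun k _ ↦ (measurable_nbRho k).const_mul _

/-- `|f_c(x)| ≤ Σ_k |c_k|`. -/
lemma abs_sum_mul_nbRho_le {N : ℕ} (c : Fin N → ℝ) (x : ℝ) :
    |∑ k : Fin N, c k * nbRho k x| ≤ ∑ k : Fin N, |c k| := by
  refine (Finset.abs_sum_le_sum_abs _ _).trans (Finset.sum_le_sum fun k _ ↦ ?_)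
  rw [abs_mul]
  have := abs_nbRho_le k x
  nlinarith [abs_nonneg (c k), abs_nonneg (nbRho k x)]

/-- `(e − f_c)²` is integrable on `(0,1]`. -/
lemma integrableOn_sq_const_sub {N : ℕ} (c : Fin N → ℝ) (e : ℝ) :
    IntegrableOn (fun x : ℝ ↦ (e - ∑ k : Fin N, c k * nbRho k x) ^ 2) (Set.Ioc (0 : ℝ) 1) := by
  refine integrableOn_Ioc_of_bounded ((measurable_const.sub (measurable_sum_mul_nbRho c)).pow_const 2)
    (M := (|e| + ∑ k : Fin N, |c k|) ^ 2) fun x ↦ ?_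
  have h1 := abs_sum_mul_nbRho_le c x
  have h2 : |e - ∑ k : Fin N, c k * nbRho k x| ≤ |e| + |∑ k : Fin N, c k * nbRho k x| := abs_sub _ _
  have h3 : |e - ∑ k : Fin N, c k * nbRho k x| ≤ |e| + ∑ k : Fin N, |c k| := by linarith
  rw [abs_pow]
  exact pow_le_pow_left₀ (abs_nonneg _) h3 2

/-- The length of the cell `I_{n+1}`. -/
lemma volume_real_nbI (n : ℕ) :
    volume.real (nbI n) = 1 / ((n : ℝ) + 1) - 1 / ((n : ℝ) + 2) := by
  rw [measureReal_def, nbI, Real.volume_Ioc, ENNReal.toReal_ofReal]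
  linarith [nbI_endpoints_le n]

/-- `|I_{n+1}| > 0`. -/
lemma volume_real_nbI_pos (n : ℕ) : 0 < volume.real (nbI n) := by
  rw [volume_real_nbI, one_div, one_div, sub_pos]
  exact inv_strictAnti₀ (by positivity) (by linarith)

/-- If `τ = 0` and `∫_{(0,1]} (e − f_c)² = 0` then `e + D_c(n+1) = 0` for every `n`
(on the cell `I_{n+1}`, `e − f_c ≡ e + D_c(n+1)` and the cell has positive length). -/
lemma const_add_sum_floor_eq_zero {N : ℕ} (c : Fin N → ℝ) (e : ℝ) (hτ : tailConst c = 0)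
    (h0 : ∫ x in Set.Ioc (0 : ℝ) 1, (e - ∑ k : Fin N, c k * nbRho k x) ^ 2 = 0) (n : ℕ) :
    e + ∑ k : Fin N, c k * (((n + 1) / ((k : ℕ) + 1) : ℕ) : ℝ) = 0 := by
  set D : ℝ := ∑ k : Fin N, c k * (((n + 1) / ((k : ℕ) + 1) : ℕ) : ℝ) with hD
  have hFi := integrableOn_sq_const_sub c e
  have hcell : ∀ x ∈ nbI n, (e - ∑ k : Fin N, c k * nbRho k x) ^ 2 = (e + D) ^ 2 := by
    intro x hx
    rw [sum_mul_nbRho_eq_of_mem_nbI c hx, hτ, zero_div, zero_sub, sub_neg_eq_add]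
  have hle : ∫ x in nbI n, (e - ∑ k : Fin N, c k * nbRho k x) ^ 2 ≤
      ∫ x in Set.Ioc (0 : ℝ) 1, (e - ∑ k : Fin N, c k * nbRho k x) ^ 2 :=
    setIntegral_mono_set hFi (ae_of_all _ fun x ↦ sq_nonneg _) (ae_of_all _ (nbI_subset n))
  have hval : ∫ x in nbI n, (e - ∑ k : Fin N, c k * nbRho k x) ^ 2 =
      volume.real (nbI n) * (e + D) ^ 2 := by
    rw [setIntegral_congr_fun (measurableSet_nbI n) hcell, setIntegral_const, smul_eq_mul]
  have hpos := volume_real_nbI_pos n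
  have hprod : volume.real (nbI n) * (e + D) ^ 2 ≤ 0 := by rw [← hval]; exact hle.trans h0.le
  have hsq : (e + D) ^ 2 ≤ 0 := by
    by_contra hne
    push Not at hne
    have := mul_pos hpos hne
    linarith
  exact pow_eq_zero_iff two_ne_zero |>.1 (le_antisymm hsq (sq_nonneg _))

/-! ## Linear independence of the dilates on Nyman's interval -/

/-- `1 − 2 log² 2 > 0` (`log 2 < 0.6931471808`). -/
lemma one_sub_two_mul_log_two_sq_pos : 0 < 1 - 2 * Real.log 2 ^ 2 := by
  have h1 : Real.log 2 < 0.6931471808 := Real.log_two_lt_d9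
  have h0 : 0 < Real.log 2 := Real.log_pos one_lt_two
  nlinarith

/-- **The dilates `ρ_1, …, ρ_N` are linearly independent in `L²(0,1]`:** `∫_{(0,1]} f_c² = 0 ⇒ c = 0`. -/
theorem eq_zero_of_integral_sq_sum_eq_zero {N : ℕ} (c : Fin N → ℝ)
    (h0 : ∫ x in Set.Ioc (0 : ℝ) 1, (∑ k : Fin N, c k * nbRho k x) ^ 2 = 0) : c = 0 := by
  -- (1) the tail constant vanishes (tail leverage on `(1/2,1]`)
  have hτ : tailConst c = 0 := by
    have h1 := nbTailLeverageBound N c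
    rw [h0] at h1
    have hc := one_sub_two_mul_log_two_sq_pos
    have hsq : tailConst c ^ 2 ≤ 0 := by
      by_contra hne
      push Not at hne
      have := mul_pos hc hne
      linarith
    exact pow_eq_zero_iff two_ne_zero |>.1 (le_antisymm hsq (sq_nonneg _))
  -- (2) every `D_c(n+1)` vanishes
  have hD : ∀ n : ℕ, ∑ k : Fin N, c k * (((n + 1) / ((k : ℕ) + 1) : ℕ) : ℝ) = 0 := by
    intro n
    have h0' : ∫ x in Set.Ioc (0 : ℝ) 1, (0 - ∑ k : Fin N, c k * nbRho k x) ^ 2 = 0 := by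
      simpa only [zero_sub, even_two.neg_pow] using h0
    simpa using const_add_sum_floor_eq_zero c 0 hτ h0' n
  -- (3) differences: `Σ_{(k+1) ∣ (m+1)} c_k = 0`
  have hdiff : ∀ m : ℕ, ∑ k : Fin N, (if (k : ℕ) + 1 ∣ m + 1 then c k else 0) = 0 := by
    intro m
    rw [← sum_floor_succ_sub c m]
    cases m with
    | zero => rw [sum_floor_zero, sub_zero]; exact hD 0
    | succ m => rw [hD (m + 1), hD m, sub_zero]
  exact eq_zero_of_sum_dvd_eq_zero c fun m _ ↦ hdiff m

/-! ## The quadratic forms -/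

/-- The HEAD form: `c·G⁰c = ∫_{(0,1]} f_c²`. -/
theorem dotProduct_nbGram0Matrix_mulVec {N : ℕ} (c : Fin N → ℝ) :
    c ⬝ᵥ (nbGram0Matrix N *ᵥ c) = ∫ x in Set.Ioc (0 : ℝ) 1, (∑ k : Fin N, c k * nbRho k x) ^ 2 := by
  have hint : ∀ j k : Fin N,
      IntegrableOn (fun x ↦ c j * c k * (nbRho j x * nbRho k x)) (Set.Ioc (0 : ℝ) 1) :=
    fun j k ↦ (integrableOn_nbRho_mul_nbRho_Ioc j k).const_mul _
  calc c ⬝ᵥ (nbGram0Matrix N *ᵥ c)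
      = ∑ j : Fin N, ∑ k : Fin N, c j * c k * nbGram0 j k := by
        simp only [dotProduct, Matrix.mulVec, nbGram0Matrix, Matrix.of_apply, Finset.mul_sum]
        exact Finset.sum_congr rfl fun j _ ↦ Finset.sum_congr rfl fun k _ ↦ by ring
    _ = ∑ j : Fin N, ∑ k : Fin N, ∫ x in Set.Ioc (0 : ℝ) 1, c j * c k * (nbRho j x * nbRho k x) := by
        refine Finset.sum_congr rfl fun j _ ↦ Finset.sum_congr rfl fun k _ ↦ ?_
        rw [integral_const_mul]
        rfl
    _ = ∫ x in Set.Ioc (0 : ℝ) 1, ∑ j : Fin N, ∑ k : Fin N, c j * c k * (nbRho j x * nbRho k x) := by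
        rw [integral_finsetSum _ (fun j _ ↦ integrable_finsetSum _ (fun k _ ↦ hint j k))]
        exact Finset.sum_congr rfl fun j _ ↦ (integral_finsetSum _ (fun k _ ↦ hint j k)).symm
    _ = ∫ x in Set.Ioc (0 : ℝ) 1, (∑ k : Fin N, c k * nbRho k x) ^ 2 := by
        refine setIntegral_congr_fun measurableSet_Ioc fun x _ ↦ ?_
        rw [sq, Finset.sum_mul_sum]
        exact Finset.sum_congr rfl fun j _ ↦ Finset.sum_congr rfl fun k _ ↦ by ring

/-- The FULL form: `c·Gc = c·G⁰c + τ²` (rank-one tail, `nbGramSplit`). -/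
theorem dotProduct_nbGramMatrix_mulVec {N : ℕ} (c : Fin N → ℝ) :
    c ⬝ᵥ (nbGramMatrix N *ᵥ c) = c ⬝ᵥ (nbGram0Matrix N *ᵥ c) + tailConst c ^ 2 := by
  simp only [dotProduct, Matrix.mulVec, nbGramMatrix, nbGram0Matrix, Matrix.of_apply]
  have h : ∀ j : Fin N, c j * ∑ k : Fin N, nbGram j k * c k =
      c j * ∑ k : Fin N, nbGram0 j k * c k +
        c j / (((j : ℕ) : ℝ) + 1) * ∑ k : Fin N, c k / (((k : ℕ) : ℝ) + 1) := by
    intro j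
    rw [Finset.mul_sum, Finset.mul_sum, Finset.mul_sum, ← Finset.sum_add_distrib]
    refine Finset.sum_congr rfl fun k _ ↦ ?_
    rw [nbGramSplit]
    have hj : ((j : ℕ) : ℝ) + 1 ≠ 0 := by positivity
    have hk : ((k : ℕ) : ℝ) + 1 ≠ 0 := by positivity
    field_simp
  rw [Finset.sum_congr rfl fun j _ ↦ h j, Finset.sum_add_distrib, ← Finset.sum_mul, tailConst, sq]

/-! ## Positive definiteness -/

/-- `G⁰` is symmetric (Hermitian over `ℝ`). -/
lemma nbGram0Matrix_isHermitian (N : ℕ) : (nbGram0Matrix N).IsHermitian :=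
  Matrix.IsHermitian.ext fun i j ↦ by simp [nbGram0Matrix, nbGram0_comm]

/-- `G` is symmetric (Hermitian over `ℝ`). -/
lemma nbGramMatrix_isHermitian (N : ℕ) : (nbGramMatrix N).IsHermitian :=
  Matrix.IsHermitian.ext fun i j ↦ by
    simp only [nbGramMatrix, Matrix.of_apply, star_trivial, nbGramSplit, nbGram0_comm (j : ℕ) (i : ℕ)]
    ring

end GramPosDef

open GramPosDef

/-- **`NbGramPosDef` (head part; RH-FREE per N, theory TARGETS §10.2 (a)).**  The Gram matrix of the dilates
`ρ_1, …, ρ_N` on NYMAN's interval `(0,1]` is positive definite. -/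
theorem nbGram0Matrix_posDef (N : ℕ) : (nbGram0Matrix N).PosDef := by
  refine Matrix.PosDef.of_dotProduct_mulVec_pos (nbGram0Matrix_isHermitian N) fun c hc ↦ ?_
  rw [star_trivial, dotProduct_nbGram0Matrix_mulVec]
  have hnn : 0 ≤ ∫ x in Set.Ioc (0 : ℝ) 1, (∑ k : Fin N, c k * nbRho k x) ^ 2 :=
    setIntegral_nonneg measurableSet_Ioc fun x _ ↦ sq_nonneg _
  rcases hnn.lt_or_eq with h | h
  · exact h
  · exact absurd (eq_zero_of_integral_sq_sum_eq_zero c h.symm) hc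

/-- **`NbGramPosDef` (RH-FREE per N, theory TARGETS §10.2 (a)).**  The Gram matrix `G = (⟨ρ_{j+1}, ρ_{k+1}⟩_{L²(0,∞)})`
of Báez-Duarte's least-squares problem is positive definite for every `N`; in particular `c⋆_N = G⁻¹ b` is well defined. -/
theorem nbGramMatrix_posDef (N : ℕ) : (nbGramMatrix N).PosDef := by
  refine Matrix.PosDef.of_dotProduct_mulVec_pos (nbGramMatrix_isHermitian N) fun c hc ↦ ?_
  have h0 := (nbGram0Matrix_posDef N).dotProduct_mulVec_pos hc
  rw [star_trivial] at h0 ⊢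
  rw [dotProduct_nbGramMatrix_mulVec]
  nlinarith [sq_nonneg (tailConst c)]

/-- **T2 made hypothesis-free.**  `nbHeadTailIdentity` with its positive-definiteness hypothesis discharged: for
`G c = b`, `G⁰ c⁰ = b`, `G⁰ u = w` (`w_k = 1/(k+1)`), `tailConst(c)·(1 + s) = tailConst(c⁰)` and
`1 − b·c = (1 − b·c⁰) + tailConst(c⁰)²/(1 + s)`, `s = Σ u_k/(k+1)`. -/
theorem nbHeadTailIdentity' (N : ℕ) (cs c0 u : Fin N → ℝ)
    (hG : ∀ k : Fin N, ∑ j : Fin N, nbGram k j * cs j = nbRhs k)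
    (hG0 : ∀ k : Fin N, ∑ j : Fin N, nbGram0 k j * c0 j = nbRhs k)
    (hu : ∀ k : Fin N, ∑ j : Fin N, nbGram0 k j * u j = 1 / ((k : ℝ) + 1)) :
    tailConst cs * (1 + ∑ k : Fin N, u k / ((k : ℝ) + 1)) = tailConst c0 ∧
      1 - ∑ k : Fin N, cs k * nbRhs k =
        (1 - ∑ k : Fin N, c0 k * nbRhs k) + tailConst c0 ^ 2 / (1 + ∑ k : Fin N, u k / ((k : ℝ) + 1)) :=
  nbHeadTailIdentity N cs c0 u (nbGram0Matrix_posDef N) hG hG0 hu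

end Summit.RiemannHypothesis.RiemannHypothesis.Theorems.NbTheory

end
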